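import Summits.BirchSwinnertonDyer.BirchSwinnertonDyer.Theorems.TwoAdicConverseOrdLambdaHalfAtTwoBDPTwoVariableDefs
import Literature.NumberTheory.EllipticCurves.LiTianYanZhu2025.CyclotomicMainConjectureOrderProofs
import Literature.NumberTheory.GaloisRepresentations.WeakAbelianDirectSummandProofs
import HarnessLib

/-!
# O2 `BDPSelmerLowerDivisibilityAtTwo` (stmt-BirchSwinnertonDyer-24728), line `two_variable_gv_squeeze_two`, stub R0T:
# the KATZ HALF of the frame OBJECT at `2` BY NAME from de Shalit II.4.17 — the frame `(Ω, δ, Ωp, LK, G)` exists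
# as soon as the two-variable Greenberg series `G` exists RELATIVE TO a given Katz datum

Helper file `--supports stmt-BirchSwinnertonDyer-24728` (LEAD `cruxlead-stmt-BirchSwinnertonDyer-19556` g11; director-bsd
(502) ruling (γ), WAKE RC-555 key (k3)(ii) «R0T = G-at-2 object + Λ_K-torsion/μ₂ = 0 … by name»).  THEOREMS ONLY (no
definition, no named fact minted, no instance, no `sorry`); the named fact
`DeShalit1987.thmII417_exists_katzSheet` (de Shalit 1987, II.4.17 (54) with Thm. 4.14 — parity-free, "`1 + 4ℤ₂` if
`p = 2`") enters as a HYPOTHESIS, so every theorem here is a conditional result in the gate's sense.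

WHAT IS PROVED.  The registered stub `stub_frameTorsion : TwoVariableFrameTorsionAtTwo` (R0T) of the line of record
`Cruxes/BDPSelmerLowerDivisibilityAtTwo/Lines/two_variable_gv_squeeze_two.lean` (v4) asks, at every datum of the
habitat (β) and every adapted pair `(κ₁, κ₂; γ₁, γ₂)`, for a frame `(Ω, δ, Ωp, LK, G)` with
`IsKatzMeasure₂ ι v v̄ ∅ κ₁ κ₂ γ₁⁻¹ γ₂⁻¹ 1 Ω δ Ωp LK` (LK IS the Katz–de Shalit two-variable measure of `K` at the split
`2`) and `IsGreenbergLFunctionFree₂ ι v v̄ κ₁ κ₂ γ₁⁻¹ γ₂⁻¹ f |d_K| h_K LK G` (G IS `𝓛_2^Gr(E/K)` in the coordinate-free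
frame), plus `Λ_K`-torsion of `X_Gr`.  The torsion conjunct is discharged from ONE line by tower-1 GEN 45
(`TwoAdicBDPLineLift.xGr₂_isTorsion_of_finite_quotient_p_CX`).  HERE: the `LK`-slot is discharged BY NAME —
`exists_katzFrame_two` (de Shalit's sheet fact ⟹ for `K` imaginary quadratic, `2 = v v̄` split with `v` induced by `ι`,
and every adapted pair, some `(Ω ≠ 0, δ² = ±d_K, Ωp ∈ R₀ˣ, LK)` satisfies the Katz frame at the INVERSE generators,
modulus `∅`, twist `1`; = `Literature…exists_isKatzMeasure₂_invGenerators` at `S = ∅`, `λ = 1`, the pattern of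
`SignedBaseChangeKatzFrame.katzFrame_of_katzSheet` at `p = 2`), and `exists_frame_two_of_katzSheet_of_forall_katz`:
the full frame exists as soon as, for EVERY admissible Katz datum `(Ω, δ, Ωp, LK)`, a Greenberg series `G` exists
relative to it (R0G — the one UNPRINTED object at `2`: Castella–Hsieh / CGS / BSTW construct `𝓛_p^Gr` for `p` odd).
Habitat form: `frameAtTwo_of_katzSheet_of_greenbergObject`, binder for binder the frame of `GreenbergLowerInclusionAt`
(`…TwoAdicConverseOrdLambdaHalfAtTwoBDPTwoVariableDefs`), `IsImaginaryQuadratic K` read off the habitat clause.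

So after this file and tower-1 GEN 45, R0T ⟸ PRINT {de Shalit II.4.17} ∧ R0G (the `G`-object) ∧ LF (one-line
finiteness).  Nothing about any elliptic curve is asserted beyond these implications; O2, 19556, 19218 stay OPEN;
BSD is proved for no curve.  References: [deShalit1987] II Thm. 4.14 (p. 71), II.4.17 (54) (p. 78), Thm. 4.12
Remarks (iii)–(iv) (p. 66–67); [CastellaGrossiSkinner2025] Thm. 2.4.1, Def. 2.4.3 (the `p`-odd `𝓛_p^Gr`);
[YanZhu2024MainConjNonCM] Def. 3.11.
-/

-- D-0017: single-problem summit, the namespace repeats the problem name by design.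
set_option linter.dupNamespace false
set_option autoImplicit false

noncomputable section

open scoped Classical NumberField
open WeierstrassCurve NumberField IsDedekindDomain Field CongruenceSubgroup
open Literature.NumberTheory.EllipticCurves Literature.NumberTheory.EllipticCurves.Rank1Residual
open Literature.NumberTheory.EllipticCurves.ModularForms
open Literature.NumberTheory.GaloisRepresentations
open Literature.NumberTheory.EllipticCurves.YanZhu2026

namespace Summit.BirchSwinnertonDyer.BirchSwinnertonDyer.Theorems.TwoAdicBDPKatzFrame

/-! ## §1 The Katz frame at the split prime `2`, modulus `∅`, twist `1`, inverse generators — by name -/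

/-- **The Katz two-variable frame EXISTS at `2`** (granted de Shalit's parity-free sheet fact): for `K` imaginary
quadratic, `2 = v v̄` split with `v` induced by `ι : ℚ̄₂ ≅ ℂ`, and every adapted pair `(κ₁, κ₂; γ₁, γ₂)`, there are
`Ω ≠ 0`, `δ` with `δ² = ±d_K`, `Ωp ∈ R₀ˣ` and `LK ∈ 𝒪_{ℂ₂}⟦T₁⟧⟦T₂⟧` with
`IsKatzMeasure₂ ι v v̄ ∅ κ₁ κ₂ γ₁⁻¹ γ₂⁻¹ 1 Ω δ Ωp LK` — the `LK`-slot of O2 / R0T.  (`λ = 1` is of finite order hence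
algebraic, and unramified everywhere by `rfl`.)
[cite: deShalit1987, II.4.17 (54) (p. 78), II Thm. 4.14 (36) (p. 71), Thm. 4.12 Remarks (iii)–(iv) (p. 66–67)] -/
theorem exists_katzFrame_two (hdS : DeShalit1987.thmII417_exists_katzSheet)
    {K : Type} [Field K] [NumberField K] [IsCMField K] (hK : IsImaginaryQuadratic K) (ι : PadicAlgCl 2 ≃+* ℂ)
    (v vbar : HeightOneSpectrum (𝓞 K)) (κ₁ κ₂ : ZpExtension K 2) (γ₁ γ₂ : absoluteGaloisGroup K)
    (hpair : ZpExtension.IsTopGeneratorPair κ₁ κ₂ γ₁ γ₂)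
    (hv : ((2 : ℕ) : 𝓞 K) ∈ v.asIdeal) (hvbar : ((2 : ℕ) : 𝓞 K) ∈ vbar.asIdeal) (hne : vbar ≠ v)
    (hι : ∀ (w : InfinitePlace K) (k : 𝓞 K), k ∈ v.asIdeal ↔ ‖ι.symm (w.embedding (k : K))‖ < 1) :
    ∃ (Ω δ : ℂ) (Ωp : (unrIntegers 2)ˣ) (LK : PowerSeries (PowerSeries (PadicComplexInt 2))),
      Ω ≠ 0 ∧ (δ ^ 2 = (NumberField.discr K : ℂ) ∨ δ ^ 2 = -(NumberField.discr K : ℂ)) ∧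
      IsKatzMeasure₂ ι v vbar ∅ κ₁ κ₂ γ₁⁻¹ γ₂⁻¹ 1 Ω δ ((Ωp : unrIntegers 2) : ℂ_[2]) LK := by
  obtain ⟨Ω, δ, Ωp, hΩ, hδ, hall⟩ := exists_isKatzMeasure₂_invGenerators hdS hK ι v vbar hv hvbar hne hι
  have halg : (1 : HeckeCharacter K).IsAlgebraic := HeckeCharacter.IsFiniteOrder.isAlgebraic IsOfFinOrder.one
  have hunr : ∀ w : HeightOneSpectrum (𝓞 K), w ∉ (∅ : Finset (HeightOneSpectrum (𝓞 K))) → w ≠ v → w ≠ vbar →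
      (1 : HeckeCharacter K).IsUnramifiedAt w :=
    fun w _ _ _ => fun _ => rfl
  obtain ⟨LK, hLK⟩ :=
    hall ∅ (Finset.notMem_empty v) (Finset.notMem_empty vbar) 1 halg hunr κ₁ κ₂ γ₁ γ₂ hpair
  exact ⟨Ω, δ, Ωp, LK, hΩ, hδ, hLK⟩

/-! ## §2 The full frame `(Ω, δ, Ωp, LK, G)` from the Katz sheet and a Greenberg series relative to every Katz datum -/

/-- **The frame of O2 / R0T exists at a datum as soon as the Greenberg series exists relative to every admissible
Katz datum** (granted de Shalit's sheet fact): the `∃ (Ω, δ, Ωp, LK, G)`-clause of `GreenbergLowerInclusionAt W K` /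
`GreenbergFrameTorsionAt W K` WITHOUT its Selmer conjuncts, at one embedding datum and one adapted pair.
[cite: deShalit1987, II.4.17 (54) (p. 78) and II Thm. 4.14 (p. 71)] [cite: CastellaGrossiSkinner2025, Def. 2.4.3] -/
theorem exists_frame_two_of_katzSheet_of_forall_katz (hdS : DeShalit1987.thmII417_exists_katzSheet)
    (W : WeierstrassCurve ℚ) [W.IsElliptic] [W.IsGloballyMinimal]
    {K : Type} [Field K] [NumberField K] [IsCMField K] (hK : IsImaginaryQuadratic K) (ι : PadicAlgCl 2 ≃+* ℂ)
    (v vbar : HeightOneSpectrum (𝓞 K)) (κ₁ κ₂ : ZpExtension K 2) (γ₁ γ₂ : absoluteGaloisGroup K)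
    (hpair : ZpExtension.IsTopGeneratorPair κ₁ κ₂ γ₁ γ₂)
    [NeZero (W.conductorNorm ℤ)] (f : CuspForm (Gamma0 (W.conductorNorm ℤ)) 2)
    (hv : ((2 : ℕ) : 𝓞 K) ∈ v.asIdeal) (hvbar : ((2 : ℕ) : 𝓞 K) ∈ vbar.asIdeal) (hne : vbar ≠ v)
    (hι : ∀ (w : InfinitePlace K) (k : 𝓞 K), k ∈ v.asIdeal ↔ ‖ι.symm (w.embedding (k : K))‖ < 1)
    (hG : ∀ (Ω δ : ℂ) (Ωp : (unrIntegers 2)ˣ) (LK : PowerSeries (PowerSeries (PadicComplexInt 2))),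
      Ω ≠ 0 → (δ ^ 2 = (NumberField.discr K : ℂ) ∨ δ ^ 2 = -(NumberField.discr K : ℂ)) →
      IsKatzMeasure₂ ι v vbar ∅ κ₁ κ₂ γ₁⁻¹ γ₂⁻¹ 1 Ω δ ((Ωp : unrIntegers 2) : ℂ_[2]) LK →
      ∃ G : PowerSeries (PowerSeries (PadicComplexInt 2)),
        IsGreenbergLFunctionFree₂ ι v vbar κ₁ κ₂ γ₁⁻¹ γ₂⁻¹ f (NumberField.discr K).natAbs
          (NumberField.classNumber K) LK G) :
    ∃ (Ω δ : ℂ) (Ωp : (unrIntegers 2)ˣ) (LK G : PowerSeries (PowerSeries (PadicComplexInt 2))),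
      Ω ≠ 0 ∧ (δ ^ 2 = (NumberField.discr K : ℂ) ∨ δ ^ 2 = -(NumberField.discr K : ℂ)) ∧
      IsKatzMeasure₂ ι v vbar ∅ κ₁ κ₂ γ₁⁻¹ γ₂⁻¹ 1 Ω δ ((Ωp : unrIntegers 2) : ℂ_[2]) LK ∧
      IsGreenbergLFunctionFree₂ ι v vbar κ₁ κ₂ γ₁⁻¹ γ₂⁻¹ f (NumberField.discr K).natAbs
        (NumberField.classNumber K) LK G := by
  obtain ⟨Ω, δ, Ωp, LK, hΩ, hδ, hLK⟩ := exists_katzFrame_two hdS hK ι v vbar κ₁ κ₂ γ₁ γ₂ hpair hv hvbar hne hι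
  obtain ⟨G, hG'⟩ := hG Ω δ Ωp LK hΩ hδ hLK
  exact ⟨Ω, δ, Ωp, LK, G, hΩ, hδ, hLK, hG'⟩

/-! ## §3 Habitat form — binder for binder the frame of `GreenbergLowerInclusionAt` on the habitat (β) of O2 -/

/-- **R0F ⟸ de Shalit II.4.17 ∧ R0G on the habitat of O2.**  If de Shalit's sheet fact holds and, for every
`(W, K)` of the habitat (β) (`E` non-CM, good ordinary at `2`, `E[2]` reducible, `K` imaginary quadratic with the
Heegner hypothesis for `2N`), every embedding datum, every adapted pair and EVERY admissible Katz datum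
`(Ω, δ, Ωp, LK)`, a Greenberg series `G` with `IsGreenbergLFunctionFree₂ … LK G` exists (R0G), then the frame
`(Ω, δ, Ωp, LK, G)` of O2 exists at every such datum (the OBJECT half of the registered stub `stub_frameTorsion`,
Selmer conjunct apart).  `IsImaginaryQuadratic K` is read off the habitat clause.
[cite: deShalit1987, II.4.17 (54) (p. 78) and II Thm. 4.14 (p. 71)] [cite: CastellaGrossiSkinner2025, Thm. 2.4.1, Def. 2.4.3] -/
theorem frameAtTwo_of_katzSheet_of_greenbergObject (hdS : DeShalit1987.thmII417_exists_katzSheet)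
    (hG : ∀ (W : WeierstrassCurve ℚ) [W.IsElliptic] [W.IsGloballyMinimal],
      ¬ W.HasCM → GoodOrd W 2 → ¬ W.HasIrreducibleModPGaloisRep 2 →
      ∀ (K : Type) [Field K] [NumberField K],
        (IsImaginaryQuadratic K ∧ SatisfiesHeegnerHypothesis (2 * W.conductorNorm ℤ) K) →
      ∀ [IsCMField K] (ι : PadicAlgCl 2 ≃+* ℂ) (v vbar : HeightOneSpectrum (𝓞 K)) (κ₁ κ₂ : ZpExtension K 2)
        (γ₁ γ₂ : absoluteGaloisGroup K) [Fact (ZpExtension.IsTopGeneratorPair κ₁ κ₂ γ₁ γ₂)]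
        [NeZero (W.conductorNorm ℤ)] (f : CuspForm (Gamma0 (W.conductorNorm ℤ)) 2),
        ModularForms.IsNewformOf W f → ∀ [NeZero (NumberField.discr K).natAbs],
        ((2 : ℕ) : 𝓞 K) ∈ v.asIdeal → ((2 : ℕ) : 𝓞 K) ∈ vbar.asIdeal → vbar ≠ v →
        (∀ (w : InfinitePlace K) (k : 𝓞 K), k ∈ v.asIdeal ↔ ‖ι.symm (w.embedding (k : K))‖ < 1) →
        ∀ (Ω δ : ℂ) (Ωp : (unrIntegers 2)ˣ) (LK : PowerSeries (PowerSeries (PadicComplexInt 2))),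
          Ω ≠ 0 → (δ ^ 2 = (NumberField.discr K : ℂ) ∨ δ ^ 2 = -(NumberField.discr K : ℂ)) →
          IsKatzMeasure₂ ι v vbar ∅ κ₁ κ₂ γ₁⁻¹ γ₂⁻¹ 1 Ω δ ((Ωp : unrIntegers 2) : ℂ_[2]) LK →
          ∃ G : PowerSeries (PowerSeries (PadicComplexInt 2)),
            IsGreenbergLFunctionFree₂ ι v vbar κ₁ κ₂ γ₁⁻¹ γ₂⁻¹ f (NumberField.discr K).natAbs
              (NumberField.classNumber K) LK G) :
    ∀ (W : WeierstrassCurve ℚ) [W.IsElliptic] [W.IsGloballyMinimal],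
      ¬ W.HasCM → GoodOrd W 2 → ¬ W.HasIrreducibleModPGaloisRep 2 →
      ∀ (K : Type) [Field K] [NumberField K],
        (IsImaginaryQuadratic K ∧ SatisfiesHeegnerHypothesis (2 * W.conductorNorm ℤ) K) →
      ∀ [IsCMField K] (ι : PadicAlgCl 2 ≃+* ℂ) (v vbar : HeightOneSpectrum (𝓞 K)) (κ₁ κ₂ : ZpExtension K 2)
        (γ₁ γ₂ : absoluteGaloisGroup K) [Fact (ZpExtension.IsTopGeneratorPair κ₁ κ₂ γ₁ γ₂)]
        [NeZero (W.conductorNorm ℤ)] (f : CuspForm (Gamma0 (W.conductorNorm ℤ)) 2),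
        ModularForms.IsNewformOf W f → ∀ [NeZero (NumberField.discr K).natAbs],
        ((2 : ℕ) : 𝓞 K) ∈ v.asIdeal → ((2 : ℕ) : 𝓞 K) ∈ vbar.asIdeal → vbar ≠ v →
        (∀ (w : InfinitePlace K) (k : 𝓞 K), k ∈ v.asIdeal ↔ ‖ι.symm (w.embedding (k : K))‖ < 1) →
        ∃ (Ω δ : ℂ) (Ωp : (unrIntegers 2)ˣ) (LK G : PowerSeries (PowerSeries (PadicComplexInt 2))),
          Ω ≠ 0 ∧ (δ ^ 2 = (NumberField.discr K : ℂ) ∨ δ ^ 2 = -(NumberField.discr K : ℂ)) ∧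
          IsKatzMeasure₂ ι v vbar ∅ κ₁ κ₂ γ₁⁻¹ γ₂⁻¹ 1 Ω δ ((Ωp : unrIntegers 2) : ℂ_[2]) LK ∧
          IsGreenbergLFunctionFree₂ ι v vbar κ₁ κ₂ γ₁⁻¹ γ₂⁻¹ f (NumberField.discr K).natAbs
            (NumberField.classNumber K) LK G := by
  intro W _ _ hCM hGO hβ K _ _ hK _ ι v vbar κ₁ κ₂ γ₁ γ₂ hpair _ f hf _ hv hvbar hne hι
  exact exists_frame_two_of_katzSheet_of_forall_katz hdS W hK.1 ι v vbar κ₁ κ₂ γ₁ γ₂ hpair.out f hv hvbar hne hι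
    (hG W hCM hGO hβ K hK ι v vbar κ₁ κ₂ γ₁ γ₂ f hf hv hvbar hne hι)

end Summit.BirchSwinnertonDyer.BirchSwinnertonDyer.Theorems.TwoAdicBDPKatzFrame

end
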